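import Summits.CriticalPhenomena.PercolationContinuityZ3.Theorems.PercNearOneGluingAdditiveGluingCSHHpart
import HarnessLib

/-!
# The set four-point transfer (K6) with its HARRIS TERM RESTORED
# (`μ(D)·Cov(g(𝒞_x),1{o↔S}) − μ(D ∩ {o↔v})·Cov(g(𝒞_x),1{v↔S}) ≥ μ(D)·Cov(g(𝒞_x), 1{o ↔ S ∪ {v}})`, `D = {v ↮ S}`)

Support file (`--supports stmt-CriticalPhenomena-4575`), prover seat `prim-rate-mine-2` (lane prim-rate, constants-miner (c), BENCH row
M2-R5, first inequality).  No definitions, no named facts, no sorries; standard axioms.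

The tree's `CSH.covTransfer_relaySet_edge` (paper Lemma 3.8, the level-zero step of the conditioned slack hierarchy / Kozma–Nitzan's
two-relay mechanism in covariance form) is proved as "Harris on `U = {o ↔ S} ∪ {o ↔ v}`" + "van den Berg–Häggström–Kahn two-set repulsion
given `v ↮ S`", and DISCARDS the Harris covariance `Cov(g(𝒞_x), 1_U) ≥ 0`.  THIS FILE keeps it:

  `μ(D ∩ {o↔v})·(∫_{v↔S} g − μ(v↔S)·m) + μ(D)·(∫_U g − μ(U)·m) ≤ μ(D)·(∫_{o↔S} g − μ(o↔S)·m)`     (`covTransfer_relaySet_edge_harrisFloor`),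

`m = ∫ g(𝒞_x)`, for EVERY monotone edge-cluster functional `g` (no sign condition: the Harris step is no longer used).  Dividing by `μ(D)²`,
this is the lane's row M2-R5: the level-0 CSH margin `Cov(g,1{o∈C_x}) − μ(o∈C_v | v↮x)·Cov(g,1{v∈C_x})` (case `S = {x}`) is at least the
plain Harris covariance `Cov(g(𝒞_x), 1{o ↔ S ∪ {v}})`, which the lane's quantitative Harris theorem (`QuantHarris.peelSum_le_cov`,
`…SahiQuantitativeHarris.lean`) bounds below by joint pivotalities with the explicit size constant `1/|E|`.  Exact census (lane): equality
(`inf margin / Harris term = 1`) is attained — the discarded vdBHK term vanishes on instances — and the Harris term is positive whenever the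
margin is (n ≤ 5 exhaustive).
[cite: VandenbergHaggstromKahn2005, Thm. 1.4 (p. 7) with Remark 1 after Thm. 1.2 (p. 5)] [cite: Harris1960, Lemma 4.1 (p. 16)]
-/

noncomputable section

namespace Summit.CriticalPhenomena.PercolationContinuityZ3.Theorems

open MeasureTheory Set Literature.Probability.LatticeModels Literature.Probability.Percolation
open Literature.Probability.Percolation.BHK2006 (openEdgeCluster_mono)
open scoped Classical
open KNPreFKG

namespace CSH

variable {V : Type*} [Fintype V]

/-- **(K6) with the Harris term kept.**  For `x ∈ S`, `g` monotone on edge sets, `m = ∫ g(𝒞_x)`, `D = {v ↮ S}`, `U = {o ↔ S} ∪ {o ↔ v}`: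
`μ(D ∩ {o↔v})·(∫_{v↔S} g(𝒞_x) − μ(v↔S)·m) + μ(D)·(∫_U g(𝒞_x) − μ(U)·m) ≤ μ(D)·(∫_{o↔S} g(𝒞_x) − μ(o↔S)·m)`.
(vdBHK Thm 1.4 with the vertex set `S`, exactly as in `covTransfer_relaySet_edge`, without spending Harris on `U`.)
[cite: VandenbergHaggstromKahn2005, Thm. 1.4 (p. 7) with Remark 1 after Thm. 1.2 (p. 5)] -/
theorem covTransfer_relaySet_edge_harrisFloor (w : Sym2 V → unitInterval) (S : Finset V) (o v x : V) (hxS : x ∈ S)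
    (g : Set (Sym2 V) → ℝ) (hg : Monotone g) :
    (prodBernoulli w).real ({ω : BondConfig V | ∀ t ∈ S, ¬ (openGraph ω).Reachable v t} ∩ openConn o v) *
          (∫ ω in (⋃ t ∈ S, openConn v t), g (openEdgeCluster ω x) ∂(prodBernoulli w) -
            (prodBernoulli w).real (⋃ t ∈ S, openConn v t) * ∫ ω, g (openEdgeCluster ω x) ∂(prodBernoulli w)) +
        (prodBernoulli w).real {ω : BondConfig V | ∀ t ∈ S, ¬ (openGraph ω).Reachable v t} *
          (∫ ω in ((⋃ t ∈ S, openConn o t) ∪ openConn o v), g (openEdgeCluster ω x) ∂(prodBernoulli w) -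
            (prodBernoulli w).real ((⋃ t ∈ S, openConn o t) ∪ openConn o v) * ∫ ω, g (openEdgeCluster ω x) ∂(prodBernoulli w)) ≤
      (prodBernoulli w).real {ω : BondConfig V | ∀ t ∈ S, ¬ (openGraph ω).Reachable v t} *
        (∫ ω in (⋃ t ∈ S, openConn o t), g (openEdgeCluster ω x) ∂(prodBernoulli w) -
          (prodBernoulli w).real (⋃ t ∈ S, openConn o t) * ∫ ω, g (openEdgeCluster ω x) ∂(prodBernoulli w)) := by
  set μ := prodBernoulli w with hμ
  set f : BondConfig V → ℝ := fun ω => g (openEdgeCluster ω x) with hf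
  set m : ℝ := ∫ ω, f ω ∂μ with hm
  have hmeas : ∀ T : Set (BondConfig V), MeasurableSet T := fun _ => MeasurableSet.of_discrete
  have hint : ∀ (k : BondConfig V → ℝ) (T : Set (BondConfig V)), IntegrableOn k T μ :=
    fun k T => (Integrable.of_finite).integrableOn
  have hn := fun (T : Set (BondConfig V)) => (measureReal_nonneg : 0 ≤ μ.real T)
  set D : Set (BondConfig V) := {ω | ∀ t ∈ S, ¬ (openGraph ω).Reachable v t} with hD
  set OT : Set (BondConfig V) := ⋃ t ∈ S, openConn o t with hOT
  set Ov : Set (BondConfig V) := openConn o v with hOv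
  set Q : Set (BondConfig V) := ⋃ t ∈ S, openConn v t with hQ
  set U : Set (BondConfig V) := OT ∪ Ov with hU
  -- two-set BHK: `g(C_x)` (increasing in `C_S`) and `{o ↔ v}` (increasing in `C_v`) are negatively correlated given `v ↮ S`
  have hind : ∀ ω : BondConfig V, (connFamily v o).indicator (1 : Set (Sym2 V) → ℝ) (⋃ s ∈ ({v} : Set V), openEdgeCluster ω s) =
      Ov.indicator (1 : BondConfig V → ℝ) ω := fun ω => by
    rw [biUnion_singleton, congrFun (indicator_comp_openEdgeCluster (connFamily v o) v) ω, ← openConn_eq_setOf_connFamily,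
      openConn_symm v o]
  have hprod : ∀ (T : Set (BondConfig V)) (k : BondConfig V → ℝ),
      ∫ ω in D, T.indicator (1 : BondConfig V → ℝ) ω * k ω ∂μ = ∫ ω in D ∩ T, k ω ∂μ := by
    intro T k
    rw [← setIntegral_mul_indicator_one μ D T k]
    refine setIntegral_congr_fun (hmeas D) fun ω _ => ?_
    ring
  have hDset : {ω : BondConfig V | ∀ s ∈ ({v} : Set V), ∀ t ∈ (↑S : Set V), ¬ (openGraph ω).Reachable s t} = D := by
    ext ω; simp [hD]
  have hGmono : Monotone (fun W : Set (Sym2 V) => g (openEdgeCluster W x)) := fun W W' h => hg (openEdgeCluster_mono h x)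
  have hGval : ∀ ω : BondConfig V, g (openEdgeCluster (⋃ t ∈ (↑S : Set V), openEdgeCluster ω t) x) = f ω := fun ω => by
    simp only [hf]; rw [CovTauStarN.openEdgeCluster_biUnion_eq (Finset.mem_coe.2 hxS)]
  have hBHK := BHK2006_twoSetConditionalAssociation.negCorrelation w ({v} : Set V) (↑S : Set V)
    ((connFamily v o).indicator 1) (fun W => g (openEdgeCluster W x))
    (monotone_indicator_one_of_isUpperSet (isUpperSet_connFamily v o)) hGmono
  simp only [hDset, hind, hGval] at hBHK
  rw [setIntegral_indicator_one_eq, hprod Ov] at hBHK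
  change μ.real D * ∫ ω in D ∩ Ov, f ω ∂μ ≤ μ.real (D ∩ Ov) * ∫ ω in D, f ω ∂μ at hBHK
  -- `U = OT ⊔ (D ∩ Ov)`
  have hUdiff : U \ OT = D ∩ Ov := by
    ext ω
    simp only [hU, hOT, hOv, hD, mem_sdiff, mem_union, mem_iUnion, mem_inter_iff, exists_prop, not_exists, not_and, openConn,
      mem_setOf_eq]
    constructor
    · rintro ⟨h | h, hno⟩
      · obtain ⟨t, ht, h'⟩ := h; exact absurd h' (hno t ht)
      · exact ⟨fun t ht hvt => hno t ht (h.trans hvt), h⟩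
    · rintro ⟨hd, hov⟩
      exact ⟨Or.inr hov, fun t ht hot => hd t ht (hov.symm.trans hot)⟩
  have hUint : ∫ ω in U, f ω ∂μ = ∫ ω in OT, f ω ∂μ + ∫ ω in D ∩ Ov, f ω ∂μ := by
    rw [← integral_inter_add_sdiff (hmeas OT) (hint f U), inter_eq_right.2 subset_union_left, hUdiff]
  have hUμ : μ.real U = μ.real OT + μ.real (D ∩ Ov) := by
    rw [← measureReal_inter_add_sdiff (s := U) (h := measure_ne_top _ _) (hmeas OT), inter_eq_right.2 subset_union_left, hUdiff]
  -- `D = Qᶜ`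
  have hDQ : D = Qᶜ := by
    ext ω
    simp [hD, hQ, openConn]
  have hDint : ∫ ω in D, f ω ∂μ = m - ∫ ω in Q, f ω ∂μ := by
    have := integral_add_compl (hmeas Q) (Integrable.of_finite (f := f) (μ := μ))
    rw [← hDQ] at this
    linarith
  have hDμ : μ.real D = 1 - μ.real Q := by
    have h1 : μ.real (univ : Set (BondConfig V)) = μ.real (univ ∩ Q) + μ.real (univ \ Q) :=
      (measureReal_inter_add_sdiff (s := univ) (h := measure_ne_top _ _) (hmeas Q)).symm
    rw [probReal_univ, univ_inter, ← compl_eq_univ_sdiff, ← hDQ] at h1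
    linarith
  -- assemble (exact bookkeeping + the single inequality hBHK)
  have hB : μ.real D * (μ.real (D ∩ Ov) * m - ∫ ω in D ∩ Ov, f ω ∂μ) ≥
      μ.real D * (μ.real (D ∩ Ov) * m) - μ.real (D ∩ Ov) * ∫ ω in D, f ω ∂μ := by
    rw [mul_sub]
    linarith [hBHK]
  rw [hDint, hDμ] at hB
  rw [hUint, hUμ, hDμ]
  nlinarith [hB, hn (D ∩ Ov), hn Q]

end CSH

end Summit.CriticalPhenomena.PercolationContinuityZ3.Theorems
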